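import Literature.NumberTheory.LFunctions.ExplicitZeroFreeRegionInputs
import HarnessLib

/-!
# The smoothing kernel and the iteration skeleton of the explicit classical zero-free region (MTY 2024, Thm. 1.3, §9)

Topic `Literature/NumberTheory/LFunctions`; third file of the decomposition of the named fact
`Literature.NumberTheory.LFunctions.zero_free_region_mossinghoff_trudgian_yang` (rh.S09, explicit
form; Mossinghoff–Trudgian–Yang, *Res. Number Theory* 10 (2024) = arXiv:2212.06867, Theorem 1.3),
after `ExplicitZeroFreeRegion.lean` (Thm. 1.3 ⟸ (A) `platt_trudgian_numerical_rh` + (B)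
`zero_free_region_mossinghoff_trudgian_yang_large_height`, proved) and
`ExplicitZeroFreeRegionInputs.lean` (the region predicate `HasClassicalZeroFreeRegion R`, Kadiri's
starting region, the kernel `mtyH1 λ θ = h^{(1)}_{λ,θ}` of MTY (9.2) with `g₁`, `d₁`). Leaf (B) —
`ζ(σ + it) ≠ 0` for `t > 3·10¹²`, `σ ≥ 1 − 1/(5.558691 log t)` — is the analytic core of
Theorem 1.3: Kadiri's global explicit-formula method (*Acta Arith.* 117 (2005): smoothed explicit
formula Prop. 2.1, the four error terms Props. 2.2–2.5, Stechkin's pairing Prop. 2.6) as optimised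
by Mossinghoff–Trudgian (*J. Number Theory* 157 (2015), §§2–4: master inequality (2.2)/(3.1),
error term `C(η)`) and run by MTY §9 with the degree-16 polynomial `F₁₆`, the kernel
`h^{(1)}_{1,θ}`, `θ = 1.13489`, `T₀ = 3·10¹²`, `r = 5`, `R = 5.573412`, in seven certified
numerical rounds (`R₀ = 5.5586904517`, Table 4 there). It is NOT discharged here (size XL: none of
Props. 2.1–2.6, `C(η)`, or the certified iteration is in the tree). **Everything in this file is
proved; no named fact is introduced.** It supplies three groups of results that any proof of (B)
along the printed lines needs, and records one structural observation about the kernel.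

## 1. The kernel `h^{(1)}_{1,θ}` is the self-convolution of Ford's `g` (MTY (4.3) = (9.2))

MTY use two smoothing devices: in §4 (Vinogradov–Korobov region) Ford's `w = g ∗ g`,
`g(u) = (cos(u tan θ) − cos θ) sec²θ` on `|u| ≤ θ cot θ` ((4.3), with
"`w(0) = (θ tan θ + 3θ cot θ − 3) sec²θ`"), and in §9 (classical region) the Heath-Brown/Jang–Kwon
kernel `h^{(1)}_{λ,θ}` of (9.2), for which "`g₁(θ) = h^{(1)}_{1,θ}(0) = (θ tan θ + 3θ cot θ − 3) sec²θ`"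
and "`d₁(θ) = 2θ cot θ`". We PROVE that these are the same function:
`fordW θ u = mtyH1 1 θ u` for `0 ≤ u ≤ 2θ cot θ`, `0 < θ < π/2` (`fordW_eq_mtyH1`; `fordG`, `fordW`
are (4.3) verbatim, `w(u) = ∫ g(t) g(u − t) dt`), by computing the window integral
`∫_{u−θcotθ}^{θcotθ} g(t)g(u−t) dt` with an explicit primitive (`fordGGPrim`, product-to-sum) and
comparing with (9.2). Consequences, all proved: (4.3) itself, `w(0) = fordSmoothW0 θ`
(`fordW_zero`); `w ≥ 0`, `w` even, `w = 0` beyond `2θ cot θ` (`fordW_nonneg`, `fordW_neg`,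
`fordW_eq_zero_of_lt`, from `g ≥ 0`, `fordG_nonneg`); hence **`h^{(1)}_{λ,θ} ≥ 0` on
`[0, d₁(θ)/λ]`** (`mtyH1_nonneg`; Kadiri's hypothesis "`f` positive", §2) and the scaling
`h^{(1)}_{λ,θ}(u) = λ h^{(1)}_{1,θ}(λu)` (`mtyH1_eq_mul_mtyH1_one`; MTY §9: adjusting `λ` gives
nothing new). The representation `h^{(1)}_{1,θ} = g ∗ g` with `g ≥ 0` even is also the route to
Kadiri's hypothesis (H₂) (`Re F(X + iY) ≥ 0` for `X ≥ 0`, `F` the Laplace transform; Heath-Brown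
1992, Lemma 7.1) and identifies `F` with Ford's closed form `W(z) = w(0)/z + W₀(z)` (MTY (4.5),
constants `fordC₀…fordC₃` of `VinogradovKorobovInputs.lean`); neither is proved here.

## 2. Kadiri's conditions (H₁) for `h^{(1)}_{λ,θ}` (Kadiri 2005, §2)

The smoothed explicit formula (Kadiri, Prop. 2.1) is stated for `f ∈ C²[0, d]` with
`f(d) = f'(0) = f'(d) = f''(d) = 0` (H₁). For the MTY kernel (`f(t) = η h^{(1)}_{λ,θ}(ηt)`,
`d = d₁(θ)/(λη)`) we give the first two derivatives in closed form (`mtyH1Deriv`, `mtyH1Deriv2`,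
with `hasDerivAt_mtyH1`, `hasDerivAt_mtyH1Deriv`) and PROVE `h'(0) = 0`, `h'(d₁/λ) = 0`,
`h''(d₁/λ) = 0` (`mtyH1Deriv_zero`, `mtyH1Deriv_d1`, `mtyH1Deriv2_d1`; `h(d₁/λ) = 0` is
`mtyH1_d1` of the Inputs file), for all `0 < θ < π/2`, `λ ≠ 0`. This also validates the in-tree
transcription of (9.2). (`h''(0) = λ³ tan θ sec²θ (tan θ − θ sec²θ)`, `mtyH1Deriv2_zero`.)

## 3. Elementary inequalities of the method

`exp_le_cubic_taylor`: `e^y ≤ 1 + y + y²/2 + y³/c` for `0 ≤ y ≤ 3 − c/2` (MTY §9 use `c = 3.47`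
for `y ≤ (r/R)d₁(θ) < 1.06 ≤ 1.265`; MT2015 §4, `c = 3.45`); `monotoneOn_log_div_log`:
`x ↦ log x/log(nx + t₀)` is increasing (MT2015 §3), whence the two lower bounds `w ≥ w₀`
(MT2015 (2.1)/(2.3), `kadiri_w_ge_w0`) and `w ≥ w₁` (MT2015 §3, `kadiri_w_ge_w1`) that feed the
monotonicity of `K(w, θ)` in the master inequality.

## 4. The iteration skeleton: what the method outputs, and how leaf (B) follows from it

MT2015 §2: "we let `T₀` be a height to which the Riemann hypothesis has been verified, and we let
`R` be a positive constant for which the classical zero-free region … has already been established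
[§1: `σ > 1 − 1/(R log|t|)`, the OPEN form — `HasOpenClassicalZeroFreeRegion R` below; their
Theorem 1 is the instance `R = 5.573412`, `hasOpenClassicalZeroFreeRegion_iff_mossinghoff_trudgian_2015`]. Also, we
let `r < R` … We suppose that `ζ(s)` has a zero `ρ₀ = β₀ + iγ₀` with `γ₀ > 0` [`> T₀` by RH
verification] … `1 − 1/(r log γ₀) ≤ β₀ ≤ 1 − 1/(R log γ₀)`. We aim to show that
`β₀ ≤ 1 − 1/(R₀ log γ₀)` for some `R₀ ∈ (r, R)`." We record this output as the predicate
`KadiriStripBound T₀ r R R₀` (Kadiri's own reading, `η = 1 − β₀`: the master inequality (2.2) bounds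
`1/((1 − β₀) log γ₀)` by `R₀ = sup A g₁(θ)(1 − κ)/(2(K(w,θ) − C(η)))`), and its companion
`KadiriStripEmpty T₀ r R` (Mossinghoff–Trudgian's reading, `η = 1/(r log γ₀)` as in their (2.1): the
same inequality reads `r ≤ A g₁(1 − κ)/(2(K − C))`, so the strip is EMPTY as soon as `r` exceeds
the fixed point of their inner iteration — e.g. any `r > 5.5586904517` in MTY §9, whose Table 4
lists the successive fixed points `5.5603156, 5.5588702, …, 5.5586905`). PROVED: one step of the
iteration in either form (`HasOpenClassicalZeroFreeRegion.of_kadiriStripBound`,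
`HasClassicalZeroFreeRegion.of_kadiriStripEmpty`: leaf (A) handles `γ ≤ T₀`, the target constant
handles zeros left of the strip, conjugation handles `γ < 0`), the `k`-round chain
(`…of_kadiriStripBound_chain`), the two forms compared (`KadiriStripEmpty.stripBound`,
`KadiriStripBound.stripEmpty`), and **leaf (B) from the output of the last round**
(`zero_free_region_mossinghoff_trudgian_yang_large_height_of_kadiriStripBound`: any output
`R₀ < 5.558691` above `T₀ = 3·10¹²` with `r = 5`; `…_of_mt2015`: from Theorem 1 of MT2015 and the
bound with `R₀ = 5.5586904517`; `…_of_kadiriStripEmpty` and `kadiriStripEmpty_iff_large_height`: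
(B) is EQUIVALENT to the emptiness of the strip `(3·10¹², 5.558691, R)` given the region `R`).
So what remains for (B) is precisely: `KadiriStripEmpty (3·10¹²) 5.558691 5.573412` (or the
seven-round chain of Table 4), i.e. Kadiri's Props. 2.1–2.6 with MT's `C(η)` for the MTY parameters
plus the certified numerics.

## References

* M. J. Mossinghoff, T. S. Trudgian, A. Yang, *Explicit zero-free regions for the Riemann
  zeta-function*, Res. Number Theory 10 (2024), no. 11 = arXiv:2212.06867: (4.3), (4.5), §9,
  (9.2), Table 4, Thm. 1.3. [cite: MossinghoffTrudgianYangRNT2024]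
* M. J. Mossinghoff, T. S. Trudgian, *Nonnegative trigonometric polynomials and a zero-free region
  for the Riemann zeta-function*, J. Number Theory 157 (2015) 329–349 = arXiv:1410.3926: §1, §2
  ((2.1)–(2.3)), §3 ((3.1), `w₁`), §4 (`C(η)`, `e^y ≤ 1 + y + y²/2 + y³/3.45`), Thm. 1.
  [cite: MossinghoffTrudgian2015]
* H. Kadiri, *Une région explicite sans zéros pour la fonction ζ de Riemann*, Acta Arith. 117
  (2005) 303–339 = arXiv:math/0401238: §2 ((H₁), (H₂), `f = η h_θ(η·)`, Props. 2.1–2.6), §2.4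
  (the iteration). [cite: Kadiri2005]
* D. R. Heath-Brown, *Zero-free regions for Dirichlet L-functions, and the least prime in an
  arithmetic progression*, Proc. London Math. Soc. (3) 64 (1992) 265–338, §7 (the kernels; cited
  through MTY §9 and Kadiri §2, not consulted).
-/

noncomputable section

open Complex Real MeasureTheory Set intervalIntegral

namespace Literature.NumberTheory.LFunctions


/-! ## Ford's function `g` and the kernel `w = g ∗ g` (MTY (4.3)) -/

/-- Ford's function `g` of Mossinghoff–Trudgian–Yang (4.3) (Ford, *Number Theory for the
Millennium II* (2002), §7; Heath-Brown 1992, §7): `g(u) = (cos(u tan θ) − cos θ) sec²θ` for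
`|u| ≤ θ cot θ` and `0` otherwise. [cite: MossinghoffTrudgianYangRNT2024, (4.3)] -/
def fordG (θ u : ℝ) : ℝ :=
  if |u| ≤ θ * Real.cot θ then (Real.cos (u * Real.tan θ) - Real.cos θ) / Real.cos θ ^ 2 else 0

/-- The smoothing kernel `w = g ∗ g` of Mossinghoff–Trudgian–Yang (4.3),
`w(u) = ∫ g(t) g(u − t) dt` (an even, non-negative, continuous function supported on
`|u| ≤ 2θ cot θ`). [cite: MossinghoffTrudgianYangRNT2024, (4.3)] -/
def fordW (θ u : ℝ) : ℝ :=
  ∫ t, fordG θ t * fordG θ (u - t)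

/-- `g` on its support. [cite: MossinghoffTrudgianYangRNT2024, (4.3)] -/
theorem fordG_of_abs_le {θ u : ℝ} (h : |u| ≤ θ * Real.cot θ) :
    fordG θ u = (Real.cos (u * Real.tan θ) - Real.cos θ) / Real.cos θ ^ 2 := if_pos h

/-- `g` vanishes off `|u| ≤ θ cot θ`. [cite: MossinghoffTrudgianYangRNT2024, (4.3)] -/
theorem fordG_of_lt_abs {θ u : ℝ} (h : θ * Real.cot θ < |u|) : fordG θ u = 0 := if_neg (not_le.2 h)

/-- `g` is even. [folklore] -/
theorem fordG_neg (θ u : ℝ) : fordG θ (-u) = fordG θ u := by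
  unfold fordG
  rw [abs_neg, neg_mul, Real.cos_neg]

/-- `θ cot θ > 0` and `tan θ > 0` for `0 < θ < π/2`. [folklore] -/
theorem theta_mul_cot_pos {θ : ℝ} (hθ : 0 < θ) (hθ' : θ < π / 2) : 0 < θ * Real.cot θ := by
  have hs : 0 < Real.sin θ := Real.sin_pos_of_pos_of_lt_pi hθ (by linarith [Real.pi_pos])
  have hc : 0 < Real.cos θ := Real.cos_pos_of_mem_Ioo ⟨by linarith, hθ'⟩
  rw [Real.cot_eq_cos_div_sin]
  positivity

/-- **`g ≥ 0`** (MTY §4: "Note that `f(u) ≥ 0` since `g(u) ≥ 0`"): for `|u| ≤ θ cot θ` one has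
`|u tan θ| ≤ θ < π`, so `cos(u tan θ) ≥ cos θ`. [cite: MossinghoffTrudgianYangRNT2024, §4] -/
theorem fordG_nonneg {θ : ℝ} (hθ : 0 < θ) (hθ' : θ < π / 2) (u : ℝ) : 0 ≤ fordG θ u := by
  unfold fordG
  split_ifs with h
  · have hs : 0 < Real.sin θ := Real.sin_pos_of_pos_of_lt_pi hθ (by linarith [Real.pi_pos])
    have hc : 0 < Real.cos θ := Real.cos_pos_of_mem_Ioo ⟨by linarith, hθ'⟩
    have htan : 0 < Real.tan θ := Real.tan_pos_of_pos_of_lt_pi_div_two hθ hθ'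
    have h1 : |u * Real.tan θ| ≤ θ := by
      rw [abs_mul, abs_of_pos htan]
      calc |u| * Real.tan θ ≤ θ * Real.cot θ * Real.tan θ :=
            mul_le_mul_of_nonneg_right h htan.le
        _ = θ := by
            rw [Real.cot_eq_cos_div_sin, Real.tan_eq_sin_div_cos]; field_simp
    have h2 : Real.cos θ ≤ Real.cos (u * Real.tan θ) := by
      rw [← Real.cos_abs (u * Real.tan θ)]
      exact Real.cos_le_cos_of_nonneg_of_le_pi (abs_nonneg _) (by linarith [Real.pi_pos]) h1
    exact div_nonneg (by linarith) (by positivity)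
  · exact le_rfl

/-! ### The product `g(t) g(u − t)` as a smooth function on a window -/

/-- The smooth expression `(cos(t tan θ) − cos θ)(cos((u − t) tan θ) − cos θ) sec⁴θ` which
`g(t) g(u − t)` equals on the window `u − θ cot θ ≤ t ≤ θ cot θ` (`0 ≤ u ≤ 2θ cot θ`).
[folklore] -/
def fordGG (θ u t : ℝ) : ℝ :=
  (Real.cos (t * Real.tan θ) - Real.cos θ) / Real.cos θ ^ 2 *
    ((Real.cos ((u - t) * Real.tan θ) - Real.cos θ) / Real.cos θ ^ 2)

/-- An explicit primitive of `fordGG θ u` in `t` (product-to-sum: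
`cos A cos B = (cos(A + B) + cos(A − B))/2` with `A + B = u tan θ`, `A − B = (2t − u) tan θ`).
[folklore] -/
def fordGGPrim (θ u t : ℝ) : ℝ :=
  (t / 2 * Real.cos (u * Real.tan θ) + Real.sin ((2 * t - u) * Real.tan θ) / (4 * Real.tan θ)
      - Real.cos θ / Real.tan θ * Real.sin (t * Real.tan θ)
      + Real.cos θ / Real.tan θ * Real.sin ((u - t) * Real.tan θ)
      + Real.cos θ ^ 2 * t) / Real.cos θ ^ 4

/-- Product-to-sum: `2 cos A cos B = cos(A + B) + cos(A − B)`. [folklore] -/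
theorem two_mul_cos_mul_cos' (A B : ℝ) :
    2 * Real.cos A * Real.cos B = Real.cos (A + B) + Real.cos (A - B) := by
  rw [Real.cos_add, Real.cos_sub]; ring

/-- `d/dt fordGGPrim θ u t = fordGG θ u t` (for `tan θ ≠ 0`, `cos θ ≠ 0`). [folklore] -/
theorem hasDerivAt_fordGGPrim {θ : ℝ} (hT : Real.tan θ ≠ 0) (u t : ℝ) :
    HasDerivAt (fordGGPrim θ u) (fordGG θ u t) t := by
  set T := Real.tan θ with hTdef
  set c := Real.cos θ with hcdef
  -- the five elementary pieces
  have h1 : HasDerivAt (fun y : ℝ ↦ y / 2 * Real.cos (u * T)) (1 / 2 * Real.cos (u * T)) t := by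
    simpa using ((hasDerivAt_id t).div_const 2).mul_const (Real.cos (u * T))
  have h2 : HasDerivAt (fun y : ℝ ↦ Real.sin ((2 * y - u) * T) / (4 * T))
      (Real.cos ((2 * t - u) * T) * (2 * T) / (4 * T)) t := by
    have hin : HasDerivAt (fun y : ℝ ↦ (2 * y - u) * T) (2 * T) t := by
      simpa using (((hasDerivAt_id t).const_mul 2).sub_const u).mul_const T
    exact ((Real.hasDerivAt_sin _).comp t hin).div_const (4 * T)
  have h3 : HasDerivAt (fun y : ℝ ↦ c / T * Real.sin (y * T)) (c / T * (Real.cos (t * T) * T)) t := by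
    have hin : HasDerivAt (fun y : ℝ ↦ y * T) T t := by
      simpa using (hasDerivAt_id t).mul_const T
    exact ((Real.hasDerivAt_sin _).comp t hin).const_mul (c / T)
  have h4 : HasDerivAt (fun y : ℝ ↦ c / T * Real.sin ((u - y) * T))
      (c / T * (Real.cos ((u - t) * T) * (-T))) t := by
    have hin : HasDerivAt (fun y : ℝ ↦ (u - y) * T) (-T) t := by
      simpa using ((hasDerivAt_id t).const_sub u).mul_const T
    exact ((Real.hasDerivAt_sin _).comp t hin).const_mul (c / T)
  have h5 : HasDerivAt (fun y : ℝ ↦ c ^ 2 * y) (c ^ 2) t := by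
    simpa using (hasDerivAt_id t).const_mul (c ^ 2)
  have hsum := (((h1.add h2).sub h3).add h4).add h5
  have hall := hsum.div_const (c ^ 4)
  have key : (1 / 2 * Real.cos (u * T) + Real.cos ((2 * t - u) * T) * (2 * T) / (4 * T)
      - c / T * (Real.cos (t * T) * T) + c / T * (Real.cos ((u - t) * T) * -T) + c ^ 2) / c ^ 4
      = fordGG θ u t := by
    have hprod : Real.cos (t * T) * Real.cos ((u - t) * T)
        = (Real.cos (u * T) + Real.cos ((2 * t - u) * T)) / 2 := by
      have := two_mul_cos_mul_cos' (t * T) ((u - t) * T)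
      rw [show t * T + (u - t) * T = u * T by ring, show t * T - (u - t) * T = (2 * t - u) * T by ring]
        at this
      linarith
    have hR : fordGG θ u t = (Real.cos (t * T) * Real.cos ((u - t) * T) - c * Real.cos (t * T)
        - c * Real.cos ((u - t) * T) + c ^ 2) / c ^ 4 := by
      unfold fordGG; rw [← hTdef, ← hcdef, div_mul_div_comm]; ring
    rw [hR, hprod]
    field_simp
    ring
  have hfun : fordGGPrim θ u = fun x ↦ (((((fun y : ℝ ↦ y / 2 * Real.cos (u * T))
      + (fun y : ℝ ↦ Real.sin ((2 * y - u) * T) / (4 * T))) - (fun y : ℝ ↦ c / T * Real.sin (y * T)))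
      + (fun y : ℝ ↦ c / T * Real.sin ((u - y) * T))) + (fun y : ℝ ↦ c ^ 2 * y)) x / c ^ 4 := by
    funext x
    simp only [fordGGPrim, Pi.add_apply, Pi.sub_apply, ← hTdef, ← hcdef]
  rw [hfun]
  exact hall.congr_deriv key

/-- `fordGG θ u` is continuous in `t`. [folklore] -/
theorem continuous_fordGG (θ u : ℝ) : Continuous (fordGG θ u) := by
  unfold fordGG; fun_prop

/-- The window integral by the fundamental theorem of calculus. [folklore] -/
theorem integral_fordGG {θ : ℝ} (hT : Real.tan θ ≠ 0) (u a b : ℝ) :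
    ∫ t in a..b, fordGG θ u t = fordGGPrim θ u b - fordGGPrim θ u a :=
  integral_eq_sub_of_hasDerivAt (fun t _ ↦ hasDerivAt_fordGGPrim hT u t)
    ((continuous_fordGG θ u).intervalIntegrable a b)

/-! ### `g(t) g(u − t)` is the window function -/

/-- For `u ≥ 0`, `g(t) g(u − t)` is `fordGG θ u t` on the window `[u − θ cot θ, θ cot θ]`
(empty when `u > 2θ cot θ`) and `0` outside it. [folklore] -/
theorem fordG_mul_fordG_eq_indicator {θ u : ℝ} (hu : 0 ≤ u) (t : ℝ) :
    fordG θ t * fordG θ (u - t) = (Icc (u - θ * Real.cot θ) (θ * Real.cot θ)).indicator (fordGG θ u) t := by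
  set a := θ * Real.cot θ with ha
  by_cases ht : t ∈ Icc (u - a) a
  · rw [indicator_of_mem ht]
    have h1 : |t| ≤ a := abs_le.2 ⟨by linarith [ht.1], ht.2⟩
    have h2 : |u - t| ≤ a := abs_le.2 ⟨by linarith [ht.2], by linarith [ht.1]⟩
    rw [fordG_of_abs_le h1, fordG_of_abs_le h2]
    rfl
  · rw [indicator_of_notMem ht]
    rw [mem_Icc, not_and_or, not_le, not_le] at ht
    rcases ht with ht | ht
    · have h2 : a < |u - t| := lt_of_lt_of_le (by linarith) (le_abs_self _)
      rw [fordG_of_lt_abs h2, mul_zero]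
    · have h1 : a < |t| := lt_of_lt_of_le ht (le_abs_self _)
      rw [fordG_of_lt_abs h1, zero_mul]

/-- Hence `w(u) = ∫_{u − θ cot θ}^{θ cot θ} fordGG θ u` for `0 ≤ u ≤ 2θ cot θ`. [folklore] -/
theorem fordW_eq_intervalIntegral {θ u : ℝ} (hu : 0 ≤ u) (hu' : u ≤ 2 * (θ * Real.cot θ)) :
    fordW θ u = ∫ t in (u - θ * Real.cot θ)..(θ * Real.cot θ), fordGG θ u t := by
  unfold fordW
  simp_rw [fordG_mul_fordG_eq_indicator hu]
  rw [MeasureTheory.integral_indicator measurableSet_Icc, integral_Icc_eq_integral_Ioc,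
    intervalIntegral.integral_of_le (by linarith)]

/-! ### The closed form: `w = h^{(1)}_{1,θ}` on `[0, 2θ cot θ]` -/

/-- **`w(u) = h^{(1)}_{1,θ}(u)` for `0 ≤ u ≤ 2θ cot θ`** (`0 < θ < π/2`): the self-convolution of
Ford's `g` (MTY (4.3)) is, on the non-negative half of its support, exactly the Heath-Brown/
Jang–Kwon kernel `h^{(1)}_{1,θ}` of MTY (9.2) (`mtyH1 1 θ`). In particular the two smoothing
kernels of Mossinghoff–Trudgian–Yang — `w` of the Vinogradov–Korobov argument (§4) and
`h^{(1)}_{1,θ}` of the classical region (§9) — are the same function, and (4.3)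
(`w(0) = (θ tan θ + 3θ cot θ − 3) sec²θ`) is the statement `g₁(θ) = h^{(1)}_{1,θ}(0)` of §9.
[cite: MossinghoffTrudgianYangRNT2024, (4.3) and (9.2)] -/
theorem fordW_eq_mtyH1 {θ u : ℝ} (hθ : 0 < θ) (hθ' : θ < π / 2) (hu : 0 ≤ u)
    (hu' : u ≤ 2 * (θ * Real.cot θ)) : fordW θ u = mtyH1 1 θ u := by
  have hs : Real.sin θ ≠ 0 := (Real.sin_pos_of_pos_of_lt_pi hθ (by linarith [Real.pi_pos])).ne'
  have hc : Real.cos θ ≠ 0 := (Real.cos_pos_of_mem_Ioo ⟨by linarith, hθ'⟩).ne'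
  have hT : Real.tan θ ≠ 0 := by rw [Real.tan_eq_sin_div_cos]; exact div_ne_zero hs hc
  rw [fordW_eq_intervalIntegral hu hu', integral_fordGG hT]
  -- evaluate the primitive at the two endpoints
  set a := θ * Real.cot θ with ha
  set T := Real.tan θ with hTdef
  set c := Real.cos θ with hcdef
  set s := Real.sin θ with hsdef
  have hTa : T = s / c := by rw [hTdef, Real.tan_eq_sin_div_cos]
  have haT : a * T = θ := by
    rw [ha, hTa, Real.cot_eq_cos_div_sin, ← hcdef, ← hsdef]; field_simp
  have e1 : (2 * a - u) * T = 2 * θ - u * T := by linear_combination (2 : ℝ) * haT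
  have e2 : (2 * (u - a) - u) * T = -(2 * θ - u * T) := by linear_combination (-2 : ℝ) * haT
  have e3 : (u - a) * T = -(θ - u * T) := by linear_combination (-1 : ℝ) * haT
  have e4 : (u - (u - a)) * T = θ := by linear_combination haT
  have hP : fordGGPrim θ u a - fordGGPrim θ u (u - a)
      = ((a - u / 2) * Real.cos (u * T) + Real.sin (2 * θ - u * T) / (2 * T)
          - 2 * (c / T) * (s + Real.sin (θ - u * T)) + c ^ 2 * (2 * a - u)) / c ^ 4 := by
    unfold fordGGPrim
    rw [← hTdef, ← hcdef, e1, e2, e3, e4, haT, ← hsdef, Real.sin_neg, Real.sin_neg]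
    field_simp
    ring
  rw [hP]
  -- and compare with (9.2) at `λ = 1`
  unfold mtyH1
  rw [← hTdef, ← hcdef, ← hsdef, Real.sin_two_mul, ← hsdef, ← hcdef]
  have haθ : a = θ * c / s := by rw [ha, Real.cot_eq_cos_div_sin, ← hcdef, ← hsdef]; ring
  rw [haθ, hTa]
  simp only [one_mul, one_div]
  field_simp
  ring

/-- `w(0) = (θ tan θ + 3θ cot θ − 3) sec²θ` — formula (4.3) of Mossinghoff–Trudgian–Yang,
PROVED from the definition `w = g ∗ g`. [cite: MossinghoffTrudgianYangRNT2024, (4.3)] -/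
theorem fordW_zero {θ : ℝ} (hθ : 0 < θ) (hθ' : θ < π / 2) : fordW θ 0 = fordSmoothW0 θ := by
  rw [fordW_eq_mtyH1 hθ hθ' le_rfl (by linarith [theta_mul_cot_pos hθ hθ']), mtyH1_one_zero hθ hθ']

/-- `w ≥ 0` everywhere (integral of a non-negative function).
[cite: MossinghoffTrudgianYangRNT2024, §4] -/
theorem fordW_nonneg {θ : ℝ} (hθ : 0 < θ) (hθ' : θ < π / 2) (u : ℝ) : 0 ≤ fordW θ u :=
  integral_nonneg fun t ↦ mul_nonneg (fordG_nonneg hθ hθ' t) (fordG_nonneg hθ hθ' (u - t))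

/-- `w` is even. [folklore] -/
theorem fordW_neg (θ u : ℝ) : fordW θ (-u) = fordW θ u := by
  unfold fordW
  rw [← integral_neg_eq_self (fun t ↦ fordG θ t * fordG θ (u - t)) volume]
  congr 1
  ext t
  rw [fordG_neg, show -u - t = -(u - -t) by ring, fordG_neg]

/-- `w(u) = 0` for `u > 2θ cot θ` (the supports of `g(t)` and `g(u − t)` are disjoint).
[folklore] -/
theorem fordW_eq_zero_of_lt {θ u : ℝ} (hu : 2 * (θ * Real.cot θ) < u) : fordW θ u = 0 := by
  unfold fordW
  have h0 : (fun t ↦ fordG θ t * fordG θ (u - t)) = fun _ ↦ (0 : ℝ) := by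
    ext t
    by_cases ht : |t| ≤ θ * Real.cot θ
    · have h2 : θ * Real.cot θ < |u - t| :=
        lt_of_lt_of_le (by linarith [(abs_le.1 ht).2]) (le_abs_self _)
      rw [fordG_of_lt_abs h2, mul_zero]
    · rw [fordG_of_lt_abs (not_le.1 ht), zero_mul]
  rw [h0, integral_zero]

/-- **`h^{(1)}_{1,θ} ≥ 0` on `[0, d₁(θ)] = [0, 2θ cot θ]`** (`0 < θ < π/2`): the positivity of the
classical-region kernel of MTY §9 ("`f` positive", hypothesis of Kadiri's method, Kadiri 2005 §2),
from `h^{(1)}_{1,θ} = g ∗ g` with `g ≥ 0`. [cite: MossinghoffTrudgianYangRNT2024, §9 and §4]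
[cite: Kadiri2005, §2 (f positive)] -/
theorem mtyH1_one_nonneg {θ u : ℝ} (hθ : 0 < θ) (hθ' : θ < π / 2) (hu : 0 ≤ u) (hu' : u ≤ mtyD1 θ) :
    0 ≤ mtyH1 1 θ u := by
  have hu'' : u ≤ 2 * (θ * Real.cot θ) := by unfold mtyD1 at hu'; linarith
  rw [← fordW_eq_mtyH1 hθ hθ' hu hu'']
  exact fordW_nonneg hθ hθ' u

/-- The parameter `λ` only rescales: `h^{(1)}_{λ,θ}(u) = λ h^{(1)}_{1,θ}(λu)` (so
`f^{(1)}_{η,λ,θ}(t) = ηλ h^{(1)}_{1,θ}(ηλt)`; MTY §9: "we set `λ = 1` since adjusting this value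
did [not] produce any further gains"). [cite: MossinghoffTrudgianYangRNT2024, §9] -/
theorem mtyH1_eq_mul_mtyH1_one (lam θ u : ℝ) (hlam : lam ≠ 0) :
    mtyH1 lam θ u = lam * mtyH1 1 θ (lam * u) := by
  unfold mtyH1
  have e : θ / (lam * Real.tan θ) = (θ / (1 * Real.tan θ)) / lam := by
    rw [one_mul, div_div, mul_comm]
  rw [e]
  simp only [one_mul, one_div]
  field_simp

/-- Hence `h^{(1)}_{λ,θ} ≥ 0` on `[0, d₁(θ)/λ]` for `λ > 0`. [cite: MossinghoffTrudgianYangRNT2024, §9] -/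
theorem mtyH1_nonneg {lam θ u : ℝ} (hlam : 0 < lam) (hθ : 0 < θ) (hθ' : θ < π / 2) (hu : 0 ≤ u)
    (hu' : u ≤ mtyD1 θ / lam) : 0 ≤ mtyH1 lam θ u := by
  rw [mtyH1_eq_mul_mtyH1_one lam θ u hlam.ne']
  refine mul_nonneg hlam.le (mtyH1_one_nonneg hθ hθ' (by positivity) ?_)
  rwa [le_div_iff₀ hlam, mul_comm] at hu'



/-! ## Kadiri's conditions (H₁) for the kernel `h^{(1)}_{λ,θ}` -/

/-- The first derivative of `h^{(1)}_{λ,θ}` (MTY (9.2)) in closed form: with `x = λu tan θ`,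
`h' = λ² sec²θ { sec²θ (−½ cos x − (θ − x/2) sin x) − 1 − tan θ cos(2θ − x)/sin 2θ
  + 2 tan θ cos(θ − x)/sin θ }`. [cite: MossinghoffTrudgianYangRNT2024, (9.2)] -/
def mtyH1Deriv (lam θ u : ℝ) : ℝ :=
  lam ^ 2 / Real.cos θ ^ 2 *
    (1 / Real.cos θ ^ 2 * (-(1 / 2) * Real.cos (lam * u * Real.tan θ)
        - (θ - lam * u * Real.tan θ / 2) * Real.sin (lam * u * Real.tan θ))
      - 1 - Real.tan θ * Real.cos (2 * θ - lam * u * Real.tan θ) / Real.sin (2 * θ)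
      + 2 * Real.tan θ * Real.cos (θ - lam * u * Real.tan θ) / Real.sin θ)

/-- The second derivative of `h^{(1)}_{λ,θ}` in closed form: with `x = λu tan θ`,
`h'' = λ³ tan θ sec²θ { sec²θ (sin x − (θ − x/2) cos x) − tan θ sin(2θ − x)/sin 2θ
  + 2 tan θ sin(θ − x)/sin θ }`. [cite: MossinghoffTrudgianYangRNT2024, (9.2)] -/
def mtyH1Deriv2 (lam θ u : ℝ) : ℝ :=
  lam ^ 3 * Real.tan θ / Real.cos θ ^ 2 *
    (1 / Real.cos θ ^ 2 * (Real.sin (lam * u * Real.tan θ)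
        - (θ - lam * u * Real.tan θ / 2) * Real.cos (lam * u * Real.tan θ))
      - Real.tan θ * Real.sin (2 * θ - lam * u * Real.tan θ) / Real.sin (2 * θ)
      + 2 * Real.tan θ * Real.sin (θ - lam * u * Real.tan θ) / Real.sin θ)

/-- `h^{(1)}_{λ,θ}` is continuous (indeed real-analytic) in `u`. [folklore] -/
theorem continuous_mtyH1 (lam θ : ℝ) : Continuous (mtyH1 lam θ) := by
  unfold mtyH1; fun_prop

/-- `d/du h^{(1)}_{λ,θ}(u) = mtyH1Deriv λ θ u` (`λ ≠ 0`, `tan θ ≠ 0`).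
[cite: MossinghoffTrudgianYangRNT2024, (9.2)] -/
theorem hasDerivAt_mtyH1 {lam θ : ℝ} (hlam : lam ≠ 0) (hT0 : Real.tan θ ≠ 0) (u : ℝ) :
    HasDerivAt (mtyH1 lam θ) (mtyH1Deriv lam θ u) u := by
  set T := Real.tan θ with hT
  set S := 1 / Real.cos θ ^ 2 with hS
  -- inner argument `x(y) = λ y tan θ`
  have hx : ∀ y : ℝ, HasDerivAt (fun y : ℝ ↦ lam * y * T) (lam * T) y := fun y ↦ by
    simpa using ((hasDerivAt_id y).const_mul lam).mul_const T
  have h1 : HasDerivAt (fun y : ℝ ↦ lam * S * (θ / (lam * T) - y / 2) * Real.cos (lam * y * T))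
      (lam * S * (-(1 / 2)) * Real.cos (lam * u * T)
        + lam * S * (θ / (lam * T) - u / 2) * (-Real.sin (lam * u * T) * (lam * T))) u := by
    have ha : HasDerivAt (fun y : ℝ ↦ lam * S * (θ / (lam * T) - y / 2)) (lam * S * (-(1 / 2))) u := by
      simpa using (((hasDerivAt_id u).div_const 2).const_sub (θ / (lam * T))).const_mul (lam * S)
    exact ha.mul ((Real.hasDerivAt_cos _).comp u (hx u))
  have h2 : HasDerivAt (fun y : ℝ ↦ 2 * θ / T - lam * y) (-lam) u := by
    simpa using ((hasDerivAt_id u).const_mul lam).const_sub (2 * θ / T)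
  have h3 : HasDerivAt (fun y : ℝ ↦ Real.sin (2 * θ - lam * y * T) / Real.sin (2 * θ))
      (Real.cos (2 * θ - lam * u * T) * (-(lam * T)) / Real.sin (2 * θ)) u :=
    ((Real.hasDerivAt_sin _).comp u ((hx u).const_sub (2 * θ))).div_const _
  have h4 : HasDerivAt (fun y : ℝ ↦ 2 * (1 + Real.sin (θ - lam * y * T) / Real.sin θ))
      (2 * (Real.cos (θ - lam * u * T) * (-(lam * T)) / Real.sin θ)) u := by
    have := (((Real.hasDerivAt_sin _).comp u ((hx u).const_sub θ)).div_const (Real.sin θ)).const_add 1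
    exact this.const_mul 2
  have hsum := (((h1.add h2).add h3).sub h4).const_mul (lam * S)
  have hfun : mtyH1 lam θ = fun y ↦ lam * S * ((fun y ↦ lam * S * (θ / (lam * T) - y / 2)
      * Real.cos (lam * y * T)) y + (fun y ↦ 2 * θ / T - lam * y) y
      + (fun y ↦ Real.sin (2 * θ - lam * y * T) / Real.sin (2 * θ)) y
      - (fun y ↦ 2 * (1 + Real.sin (θ - lam * y * T) / Real.sin θ)) y) := by
    funext y
    simp only [mtyH1, ← hT, hS]
    ring
  rw [hfun]
  refine hsum.congr_deriv ?_
  simp only [mtyH1Deriv, ← hT, hS]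
  field_simp
  ring

/-- `d/du mtyH1Deriv λ θ u = mtyH1Deriv2 λ θ u`. [cite: MossinghoffTrudgianYangRNT2024, (9.2)] -/
theorem hasDerivAt_mtyH1Deriv (lam θ u : ℝ) :
    HasDerivAt (mtyH1Deriv lam θ) (mtyH1Deriv2 lam θ u) u := by
  set T := Real.tan θ with hT
  set S := 1 / Real.cos θ ^ 2 with hS
  have hx : ∀ y : ℝ, HasDerivAt (fun y : ℝ ↦ lam * y * T) (lam * T) y := fun y ↦ by
    simpa using ((hasDerivAt_id y).const_mul lam).mul_const T
  have h1 : HasDerivAt (fun y : ℝ ↦ -(1 / 2) * Real.cos (lam * y * T))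
      (-(1 / 2) * (-Real.sin (lam * u * T) * (lam * T))) u :=
    ((Real.hasDerivAt_cos _).comp u (hx u)).const_mul _
  have h2 : HasDerivAt (fun y : ℝ ↦ (θ - lam * y * T / 2) * Real.sin (lam * y * T))
      (-(lam * T / 2) * Real.sin (lam * u * T)
        + (θ - lam * u * T / 2) * (Real.cos (lam * u * T) * (lam * T))) u := by
    have ha : HasDerivAt (fun y : ℝ ↦ θ - lam * y * T / 2) (-(lam * T / 2)) u := by
      simpa using ((hx u).div_const 2).const_sub θ
    exact ha.mul ((Real.hasDerivAt_sin _).comp u (hx u))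
  have h3 : HasDerivAt (fun y : ℝ ↦ T * Real.cos (2 * θ - lam * y * T) / Real.sin (2 * θ))
      (T * (-Real.sin (2 * θ - lam * u * T) * (-(lam * T))) / Real.sin (2 * θ)) u :=
    (((Real.hasDerivAt_cos _).comp u ((hx u).const_sub (2 * θ))).const_mul T).div_const _
  have h4 : HasDerivAt (fun y : ℝ ↦ 2 * T * Real.cos (θ - lam * y * T) / Real.sin θ)
      (2 * T * (-Real.sin (θ - lam * u * T) * (-(lam * T))) / Real.sin θ) u :=
    (((Real.hasDerivAt_cos _).comp u ((hx u).const_sub θ)).const_mul (2 * T)).div_const _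
  have hsum := (((((h1.sub h2).const_mul S).sub_const 1).sub h3).add h4).const_mul (lam ^ 2 * S)
  have hfun : mtyH1Deriv lam θ = fun y ↦ lam ^ 2 * S * (S * ((fun y ↦ -(1 / 2) * Real.cos (lam * y * T)) y
      - (fun y ↦ (θ - lam * y * T / 2) * Real.sin (lam * y * T)) y) - 1
      - (fun y ↦ T * Real.cos (2 * θ - lam * y * T) / Real.sin (2 * θ)) y
      + (fun y ↦ 2 * T * Real.cos (θ - lam * y * T) / Real.sin θ) y) := by
    funext y
    simp only [mtyH1Deriv, ← hT, hS]
    ring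
  rw [hfun]
  refine hsum.congr_deriv ?_
  simp only [mtyH1Deriv2, ← hT, hS]
  ring

/-- `deriv h^{(1)}_{λ,θ} = mtyH1Deriv λ θ` (`λ ≠ 0`, `tan θ ≠ 0`). [folklore] -/
theorem deriv_mtyH1 {lam θ : ℝ} (hlam : lam ≠ 0) (hT0 : Real.tan θ ≠ 0) :
    deriv (mtyH1 lam θ) = mtyH1Deriv lam θ :=
  funext fun u ↦ (hasDerivAt_mtyH1 hlam hT0 u).deriv

/-- `deriv (deriv h^{(1)}_{λ,θ}) = mtyH1Deriv2 λ θ` (`λ ≠ 0`, `tan θ ≠ 0`). [folklore] -/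
theorem deriv2_mtyH1 {lam θ : ℝ} (hlam : lam ≠ 0) (hT0 : Real.tan θ ≠ 0) :
    deriv (deriv (mtyH1 lam θ)) = mtyH1Deriv2 lam θ := by
  rw [deriv_mtyH1 hlam hT0]
  exact funext fun u ↦ (hasDerivAt_mtyH1Deriv lam θ u).deriv

/-- **(H₁), `f'(0) = 0`:** `h^{(1)}_{λ,θ}` has vanishing derivative at `0` (`0 < θ < π/2`; any
`λ`): at `x = 0` the bracket is `−sec²θ/2 − 1 − tan θ cot 2θ + 2 = 0`. This is the condition
`f'(0) = 0` of Kadiri's hypothesis (H₁) on the test function (Kadiri 2005, §2), for the kernel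
(9.2) of Mossinghoff–Trudgian–Yang. [cite: Kadiri2005, §2 (H₁)]
[cite: MossinghoffTrudgianYangRNT2024, (9.2)] -/
theorem mtyH1Deriv_zero {θ : ℝ} (lam : ℝ) (hθ : 0 < θ) (hθ' : θ < π / 2) :
    mtyH1Deriv lam θ 0 = 0 := by
  have hs : Real.sin θ ≠ 0 := (Real.sin_pos_of_pos_of_lt_pi hθ (by linarith [Real.pi_pos])).ne'
  have hc : Real.cos θ ≠ 0 := (Real.cos_pos_of_mem_Ioo ⟨by linarith, hθ'⟩).ne'
  unfold mtyH1Deriv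
  simp only [mul_zero, zero_mul, sub_zero, Real.cos_zero, Real.sin_zero, zero_div, mul_one]
  rw [Real.sin_two_mul, Real.cos_two_mul, Real.tan_eq_sin_div_cos]
  field_simp
  ring

/-- **(H₁), `f'(d) = 0`:** the derivative of `h^{(1)}_{λ,θ}` vanishes at the support endpoint
`u = d₁(θ)/λ = 2θ cot θ/λ` (`0 < θ < π/2`, `λ ≠ 0`): at `x = 2θ` the bracket is
`−sec²θ cos 2θ/2 − 1 − tan θ/sin 2θ + 2 = 0`. [cite: Kadiri2005, §2 (H₁)]
[cite: MossinghoffTrudgianYangRNT2024, (9.2) and §9 (d₁ = 2θ cot θ)] -/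
theorem mtyH1Deriv_d1 {lam θ : ℝ} (hlam : lam ≠ 0) (hθ : 0 < θ) (hθ' : θ < π / 2) :
    mtyH1Deriv lam θ (mtyD1 θ / lam) = 0 := by
  have hs : Real.sin θ ≠ 0 := (Real.sin_pos_of_pos_of_lt_pi hθ (by linarith [Real.pi_pos])).ne'
  have hc : Real.cos θ ≠ 0 := (Real.cos_pos_of_mem_Ioo ⟨by linarith, hθ'⟩).ne'
  have hkey : lam * (mtyD1 θ / lam) * Real.tan θ = 2 * θ := by
    unfold mtyD1
    rw [Real.cot_eq_cos_div_sin, Real.tan_eq_sin_div_cos]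
    field_simp
  unfold mtyH1Deriv
  rw [hkey, show 2 * θ - 2 * θ = 0 by ring, show θ - 2 * θ = -θ by ring, show θ - 2 * θ / 2 = 0 by ring,
    Real.cos_zero, Real.cos_neg, zero_mul, sub_zero, Real.sin_two_mul, Real.cos_two_mul,
    Real.tan_eq_sin_div_cos]
  field_simp
  ring

/-- **(H₁), `f''(d) = 0`:** the second derivative of `h^{(1)}_{λ,θ}` vanishes at the support
endpoint `u = 2θ cot θ/λ` (`0 < θ < π/2`, `λ ≠ 0`): at `x = 2θ` the bracket is
`sec²θ sin 2θ − 2 tan θ = 0`. Together with `mtyH1_d1` (`f(d) = 0`) and `mtyH1Deriv_zero`,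
`mtyH1Deriv_d1` these are the four conditions (H₁) `f(d) = f'(0) = f'(d) = f''(d) = 0` of Kadiri
2005, §2 for the kernel (9.2) of Mossinghoff–Trudgian–Yang (hypotheses of the smoothed explicit
formula, Kadiri's Proposition 2.1). [cite: Kadiri2005, §2 (H₁) and Proposition 2.1]
[cite: MossinghoffTrudgianYangRNT2024, (9.2)] -/
theorem mtyH1Deriv2_d1 {lam θ : ℝ} (hlam : lam ≠ 0) (hθ : 0 < θ) (hθ' : θ < π / 2) :
    mtyH1Deriv2 lam θ (mtyD1 θ / lam) = 0 := by
  have hs : Real.sin θ ≠ 0 := (Real.sin_pos_of_pos_of_lt_pi hθ (by linarith [Real.pi_pos])).ne'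
  have hc : Real.cos θ ≠ 0 := (Real.cos_pos_of_mem_Ioo ⟨by linarith, hθ'⟩).ne'
  have hkey : lam * (mtyD1 θ / lam) * Real.tan θ = 2 * θ := by
    unfold mtyD1
    rw [Real.cot_eq_cos_div_sin, Real.tan_eq_sin_div_cos]
    field_simp
  unfold mtyH1Deriv2
  rw [hkey, show 2 * θ - 2 * θ = 0 by ring, show θ - 2 * θ = -θ by ring, show θ - 2 * θ / 2 = 0 by ring,
    Real.sin_zero, Real.sin_neg, zero_mul, sub_zero, Real.sin_two_mul, Real.tan_eq_sin_div_cos]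
  field_simp
  ring

/-- The value `h''(0) = λ³ tan θ sec²θ (tan θ − θ sec²θ)` (negative for `0 < θ < π/2`, since
`θ > sin θ cos θ`); for Kadiri's kernel `h^{(4)}` the analogous value gives `m = |h''(0)|`
(Kadiri 2005, Lemma 3.2). [cite: MossinghoffTrudgianYangRNT2024, (9.2)] -/
theorem mtyH1Deriv2_zero {θ : ℝ} (lam : ℝ) (hθ : 0 < θ) (hθ' : θ < π / 2) :
    mtyH1Deriv2 lam θ 0 = lam ^ 3 * Real.tan θ / Real.cos θ ^ 2 *
      (Real.tan θ - θ / Real.cos θ ^ 2) := by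
  have hs : Real.sin θ ≠ 0 := (Real.sin_pos_of_pos_of_lt_pi hθ (by linarith [Real.pi_pos])).ne'
  have hc : Real.cos θ ≠ 0 := (Real.cos_pos_of_mem_Ioo ⟨by linarith, hθ'⟩).ne'
  unfold mtyH1Deriv2
  simp only [mul_zero, zero_mul, sub_zero, Real.sin_zero, Real.cos_zero, zero_div, mul_one, zero_sub]
  rw [Real.sin_two_mul, Real.tan_eq_sin_div_cos]
  field_simp
  ring



/-! ## Two elementary inequalities of the method -/

/-- **The cubic exponential bound of MTY §9 / MT2015 §4** on the range where it is used.
Mossinghoff–Trudgian–Yang (§9, third bullet) use `e^y ≤ 1 + y + y²/2 + y³/3.47`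
(Mossinghoff–Trudgian 2015, §4: the same with `3.45`) to bound `M(z, θ) = ∫₀^{d₁} |h''(u)| e^{−zu} du`
at `z = −r/R` by the moments `M_k(θ)`; there `y = (r/R)u ≤ d₁(θ) ≈ 1.06`. We prove the bound
for a general constant `0 < c` on `0 ≤ y ≤ 3 − c/2` (for `c = 3.47`: `y ≤ 1.265`, covering
`d₁(1.13489) = 1.057…`): the function `e^{−y}(1 + y + y²/2 + y³/c)` has derivative
`e^{−y} y² (3/c − 1/2 − y/c) ≥ 0` there and value `1` at `0`. (MTY state validity up to the
crossing point `y = 1.89355`; that larger range is not needed by the method and not proved here.)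
[cite: MossinghoffTrudgianYangRNT2024, §9] [cite: MossinghoffTrudgian2015, §4] -/
theorem exp_le_cubic_taylor {c y : ℝ} (hc : 0 < c) (hy : 0 ≤ y) (hyc : y ≤ 3 - c / 2) :
    Real.exp y ≤ 1 + y + y ^ 2 / 2 + y ^ 3 / c := by
  -- `φ(y) = e^{-y} (1 + y + y²/2 + y³/c)` is monotone on `[0, 3 - c/2]`
  set φ : ℝ → ℝ := fun y ↦ Real.exp (-y) * (1 + y + y ^ 2 / 2 + y ^ 3 / c) with hφ
  have hderiv : ∀ x : ℝ, HasDerivAt φ (Real.exp (-x) * (x ^ 2 * (3 / c - 1 / 2 - x / c))) x := by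
    intro x
    have h1 : HasDerivAt (fun y : ℝ ↦ Real.exp (-y)) (-Real.exp (-x)) x :=
      ((Real.hasDerivAt_exp (-x)).comp x (hasDerivAt_neg x)).congr_deriv (by ring)
    have h2 : HasDerivAt (fun y : ℝ ↦ 1 + y + y ^ 2 / 2 + y ^ 3 / c)
        (1 + (2 : ℕ) * x ^ (2 - 1) / 2 + (3 : ℕ) * x ^ (3 - 1) / c) x :=
      (((hasDerivAt_id' x).const_add 1).add ((hasDerivAt_pow 2 x).div_const 2)).add
        ((hasDerivAt_pow 3 x).div_const c)
    refine (h1.mul h2).congr_deriv ?_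
    push_cast
    field_simp
    ring
  have hmono : MonotoneOn φ (Icc 0 (3 - c / 2)) := by
    refine monotoneOn_of_deriv_nonneg (convex_Icc _ _) ?_ ?_ ?_
    · exact HasDerivAt.continuousOn fun x _ ↦ hderiv x
    · exact fun x _ ↦ (hderiv x).differentiableAt.differentiableWithinAt
    · intro x hx
      rw [interior_Icc] at hx
      rw [(hderiv x).deriv]
      refine mul_nonneg (Real.exp_pos _).le (mul_nonneg (sq_nonneg _) ?_)
      have : x / c ≤ (3 - c / 2) / c := div_le_div_of_nonneg_right hx.2.le hc.le
      have h3 : (3 - c / 2) / c = 3 / c - 1 / 2 := by field_simp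
      linarith
  have h0 : φ 0 = 1 := by simp [hφ]
  have hφy : 1 ≤ φ y := h0 ▸ hmono ⟨le_rfl, by linarith⟩ ⟨hy, hyc⟩ hy
  have key : Real.exp y * φ y = 1 + y + y ^ 2 / 2 + y ^ 3 / c := by
    simp only [hφ, ← mul_assoc, ← Real.exp_add, add_neg_cancel, Real.exp_zero, one_mul]
  calc Real.exp y = Real.exp y * 1 := (mul_one _).symm
    _ ≤ Real.exp y * φ y := mul_le_mul_of_nonneg_left hφy (Real.exp_pos _).le
    _ = _ := key

/-- **Monotonicity behind `w ≥ w₀` and `w ≥ w₁`** (Mossinghoff–Trudgian 2015, §3: "since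
`log x/log(nx + t₀)` is increasing in `x` for fixed `n` and `t₀`"): for `1 ≤ n`, `1 ≤ t₀` the
function `x ↦ log x / log(nx + t₀)` is monotone on `[1, ∞)`. Proof: its derivative has the sign
of `x⁻¹ log(nx + t₀) − log x · n/(nx + t₀) ≥ 0` (`n/(nx + t₀) ≤ 1/x`, `log x ≤ log(nx + t₀)`).
[cite: MossinghoffTrudgian2015, §3] -/
theorem monotoneOn_log_div_log {n t₀ : ℝ} (hn : 1 ≤ n) (ht₀ : 1 ≤ t₀) :
    MonotoneOn (fun x : ℝ ↦ Real.log x / Real.log (n * x + t₀)) (Ici 1) := by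
  have hpos : ∀ x : ℝ, 1 ≤ x → 2 ≤ n * x + t₀ := fun x hx ↦ by nlinarith
  have hderiv : ∀ x : ℝ, 1 ≤ x → HasDerivAt (fun x : ℝ ↦ Real.log x / Real.log (n * x + t₀))
      ((x⁻¹ * Real.log (n * x + t₀) - Real.log x * (n / (n * x + t₀))) / Real.log (n * x + t₀) ^ 2) x := by
    intro x hx
    have hx0 : x ≠ 0 := by positivity
    have h2 : n * x + t₀ ≠ 0 := by linarith [hpos x hx]
    have hlog2 : Real.log (n * x + t₀) ≠ 0 :=
      (Real.log_pos (by linarith [hpos x hx])).ne'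
    have hin : HasDerivAt (fun x : ℝ ↦ n * x + t₀) n x := by
      simpa using ((hasDerivAt_id x).const_mul n).add_const t₀
    have hd2 : HasDerivAt (fun x : ℝ ↦ Real.log (n * x + t₀)) (n / (n * x + t₀)) x := by
      refine HasDerivAt.congr_deriv ((Real.hasDerivAt_log h2).comp x hin :) ?_
      rw [div_eq_mul_inv, mul_comm]
    exact (Real.hasDerivAt_log hx0).div hd2 hlog2
  refine monotoneOn_of_deriv_nonneg (convex_Ici 1) ?_ ?_ ?_
  · exact HasDerivAt.continuousOn fun x hx ↦ hderiv x hx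
  · intro x hx
    rw [interior_Ici] at hx
    exact (hderiv x (le_of_lt hx)).differentiableAt.differentiableWithinAt
  · intro x hx
    rw [interior_Ici] at hx
    have hx1 : 1 ≤ x := le_of_lt hx
    have hxpos : 0 < x := by linarith
    rw [(hderiv x hx1).deriv]
    have hL1 : 0 ≤ Real.log x := Real.log_nonneg hx1
    have hnx : x ≤ n * x + t₀ := by nlinarith
    have hL2 : Real.log x ≤ Real.log (n * x + t₀) := Real.log_le_log hxpos hnx
    have hL2pos : 0 < Real.log (n * x + t₀) := Real.log_pos (by linarith [hpos x hx1])
    have h1 : n / (n * x + t₀) ≤ x⁻¹ := by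
      rw [inv_eq_one_div, div_le_div_iff₀ (by linarith) hxpos]
      nlinarith
    have h2 : Real.log x * (n / (n * x + t₀)) ≤ Real.log (n * x + t₀) * x⁻¹ :=
      mul_le_mul hL2 h1 (by positivity) hL2pos.le
    refine div_nonneg ?_ (sq_nonneg _)
    linarith [mul_comm (Real.log (n * x + t₀)) x⁻¹]

/-- **`w ≥ w₀`** (Mossinghoff–Trudgian 2015, (2.1): `w = (1 − σ)/η`, `σ = 1 − 1/(R log(nγ₀ + t₀))`,
`w₀ = (1 − σ₀)/η₀ = r log T₀/(R log(nT₀ + t₀))`; Kadiri proves `K(w, θ)` increasing for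
`w ≥ w₀`): for a zero at height `γ₀ ≥ T₀ ≥ 1` (hence `> 1`) whose distance `η > 0` from the line
`σ = 1` satisfies `η ≤ 1/(r log γ₀)` (`r > 0`), one has
`r log T₀/(R log(nT₀ + t₀)) ≤ (1/(R log(nγ₀ + t₀)))/η` (`R > 0`, `n, t₀ ≥ 1`).
[cite: MossinghoffTrudgian2015, (2.1) and (2.3)] -/
theorem kadiri_w_ge_w0 {r R n t₀ T₀ γ₀ η : ℝ} (hr : 0 < r) (hR : 0 < R) (hn : 1 ≤ n) (ht₀ : 1 ≤ t₀)
    (hT₀ : 1 < T₀) (hγ : T₀ ≤ γ₀) (hη : 0 < η) (hηr : η ≤ 1 / (r * Real.log γ₀)) :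
    r * Real.log T₀ / (R * Real.log (n * T₀ + t₀)) ≤ 1 / (R * Real.log (n * γ₀ + t₀)) / η := by
  have hlogγ : 0 < Real.log γ₀ := Real.log_pos (by linarith)
  have hlogT : 0 < Real.log (n * T₀ + t₀) := Real.log_pos (by nlinarith)
  have hlogG : 0 < Real.log (n * γ₀ + t₀) := Real.log_pos (by nlinarith)
  have hmono := monotoneOn_log_div_log hn ht₀ (show (1 : ℝ) ≤ T₀ from hT₀.le)
    (show (1 : ℝ) ≤ γ₀ by linarith) hγ
  simp only at hmono
  -- `1/η ≥ r log γ₀`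
  have hinv : r * Real.log γ₀ ≤ 1 / η := by
    rw [le_div_iff₀ hη]
    calc r * Real.log γ₀ * η ≤ r * Real.log γ₀ * (1 / (r * Real.log γ₀)) :=
          mul_le_mul_of_nonneg_left hηr (by positivity)
      _ = 1 := by field_simp
  calc r * Real.log T₀ / (R * Real.log (n * T₀ + t₀))
      = r / R * (Real.log T₀ / Real.log (n * T₀ + t₀)) := by field_simp
    _ ≤ r / R * (Real.log γ₀ / Real.log (n * γ₀ + t₀)) :=
          mul_le_mul_of_nonneg_left hmono (by positivity)
    _ = r * Real.log γ₀ * (1 / (R * Real.log (n * γ₀ + t₀))) := by field_simp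
    _ ≤ 1 / η * (1 / (R * Real.log (n * γ₀ + t₀))) :=
          mul_le_mul_of_nonneg_right hinv (by positivity)
    _ = 1 / (R * Real.log (n * γ₀ + t₀)) / η := by field_simp

/-- **`w ≥ w₁`** (Mossinghoff–Trudgian 2015, §3, with `η = 1/(r log γ₀)` as in their (2.1)): if
`η ≤ η₁` then `γ₀ ≥ exp(1/(rη₁))` and
`w = r log γ₀/(R log(nγ₀ + t₀)) ≥ (1/(Rη₁))/log(n e^{1/(rη₁)} + t₀) =: w₁`.
[cite: MossinghoffTrudgian2015, §3 (definition of w₁)] -/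
theorem kadiri_w_ge_w1 {r R n t₀ γ₀ η₁ : ℝ} (hr : 0 < r) (hR : 0 < R) (hn : 1 ≤ n) (ht₀ : 1 ≤ t₀)
    (hγ : 1 < γ₀) (hη₁ : 0 < η₁) (hle : 1 / (r * Real.log γ₀) ≤ η₁) :
    1 / (R * η₁) / Real.log (n * Real.exp (1 / (r * η₁)) + t₀)
      ≤ r * Real.log γ₀ / (R * Real.log (n * γ₀ + t₀)) := by
  have hlogγ : 0 < Real.log γ₀ := Real.log_pos hγ
  set x₁ : ℝ := Real.exp (1 / (r * η₁)) with hx₁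
  have hx₁1 : 1 ≤ x₁ := by
    rw [hx₁]; exact Real.one_le_exp (by positivity)
  -- `γ₀ ≥ x₁`
  have hγx : x₁ ≤ γ₀ := by
    rw [hx₁, ← Real.exp_log (by linarith : 0 < γ₀)]
    apply Real.exp_le_exp.2
    rw [div_le_iff₀ (by positivity)]
    rw [div_le_iff₀ (by positivity)] at hle
    nlinarith
  have hmono := monotoneOn_log_div_log hn ht₀ (show x₁ ∈ Ici (1 : ℝ) from hx₁1)
    (show γ₀ ∈ Ici (1 : ℝ) from hγ.le) hγx
  simp only at hmono
  rw [hx₁, Real.log_exp] at hmono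
  have hlog1 : 0 < Real.log (n * x₁ + t₀) := Real.log_pos (by nlinarith)
  have hlogG : 0 < Real.log (n * γ₀ + t₀) := Real.log_pos (by nlinarith)
  calc 1 / (R * η₁) / Real.log (n * Real.exp (1 / (r * η₁)) + t₀)
      = r / R * (1 / (r * η₁) / Real.log (n * x₁ + t₀)) := by rw [hx₁]; field_simp
    _ ≤ r / R * (Real.log γ₀ / Real.log (n * γ₀ + t₀)) :=
          mul_le_mul_of_nonneg_left hmono (by positivity)
    _ = r * Real.log γ₀ / (R * Real.log (n * γ₀ + t₀)) := by field_simp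



/-! ## The open classical region and the output of one run of Kadiri's method -/

/-- The classical zero-free region with constant `R` in the **open** form of Mossinghoff–Trudgian
2015 (§1: "`ζ(s) ≠ 0` in a region of the form `σ > 1 − 1/(R₀ log|t|)` … we refer to a region of
this form as a classical zero-free region"; their Theorem 1 is the case `R = 5.573412`): for
`|t| ≥ 2` and `σ > 1 − 1/(R log|t|)`, `ζ(σ + it) ≠ 0`. Equivalently every zero `β + iγ` with
`|γ| ≥ 2` has `β ≤ 1 − 1/(R log|γ|)`. A predicate on `R` (content only for `R > 0`).
[cite: MossinghoffTrudgian2015, §1 and Theorem 1] -/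
def HasOpenClassicalZeroFreeRegion (R : ℝ) : Prop :=
  ∀ σ t : ℝ, 2 ≤ |t| → 1 - 1 / (R * Real.log |t|) < σ → riemannZeta (σ + t * I) ≠ 0

/-- **(B₀) Theorem 1 of Mossinghoff–Trudgian 2015** — "There are no zeros of `ζ(σ + it)` for
`|t| ≥ 2` and `σ > 1 − 1/(5.573412 log|t|)`" (the statement spelled out on the right, as in
`zero_free_region_mossinghoff_trudgian_2015_of_hasClassicalZeroFreeRegion` of
`ExplicitZeroFreeRegionInputs.lean`) — is, verbatim, the open classical region with `R = 5.573412`.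
It is proved from leaf (A) alone in `ExplicitZeroFreeRegionRoundsProofs.lean` and is therefore not
a named fact of the tree (D-0026 review, 2026-08-15). [cite: MossinghoffTrudgian2015, Theorem 1] -/
theorem hasOpenClassicalZeroFreeRegion_iff_mossinghoff_trudgian_2015 :
    HasOpenClassicalZeroFreeRegion 5.573412 ↔
      ∀ σ t : ℝ, 2 ≤ |t| → 1 - 1 / (5.573412 * Real.log |t|) < σ → riemannZeta (σ + t * I) ≠ 0 :=
  Iff.rfl

/-- The closed region with constant `R` contains the open one. [folklore] -/
theorem HasClassicalZeroFreeRegion.hasOpen {R : ℝ} (h : HasClassicalZeroFreeRegion R) :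
    HasOpenClassicalZeroFreeRegion R :=
  fun σ t ht hσ ↦ h σ t ht hσ.le

/-- The open region with constant `R > 0` gives the closed region with any larger constant
`R' > R`. [folklore] -/
theorem HasOpenClassicalZeroFreeRegion.hasClassical {R R' : ℝ} (h : HasOpenClassicalZeroFreeRegion R)
    (hR : 0 < R) (hRR' : R < R') : HasClassicalZeroFreeRegion R' := by
  intro σ t ht hσ
  refine h σ t ht ?_
  have hlog : 0 < Real.log |t| :=
    (Real.log_pos one_lt_two).trans_le (Real.log_le_log two_pos ht)
  have hlt : 1 / (R' * Real.log |t|) < 1 / (R * Real.log |t|) :=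
    one_div_lt_one_div_of_lt (by positivity) (by nlinarith)
  linarith

/-- Monotonicity of the open region in the constant: `0 < R ≤ R'`. [folklore] -/
theorem HasOpenClassicalZeroFreeRegion.mono {R R' : ℝ} (h : HasOpenClassicalZeroFreeRegion R)
    (hR : 0 < R) (hRR' : R ≤ R') : HasOpenClassicalZeroFreeRegion R' := by
  intro σ t ht hσ
  refine h σ t ht ?_
  have hlog : 0 < Real.log |t| :=
    (Real.log_pos one_lt_two).trans_le (Real.log_le_log two_pos ht)
  have hle : 1 / (R' * Real.log |t|) ≤ 1 / (R * Real.log |t|) :=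
    one_div_le_one_div_of_le (by positivity) (by nlinarith)
  linarith

/-- In zero form: under the open region with constant `R`, a zero `β + iγ` with `|γ| ≥ 2` has
`β ≤ 1 − 1/(R log|γ|)`. [cite: MossinghoffTrudgian2015, §2] -/
theorem HasOpenClassicalZeroFreeRegion.re_le {R β γ : ℝ} (h : HasOpenClassicalZeroFreeRegion R)
    (hγ : 2 ≤ |γ|) (hz : riemannZeta (β + γ * I) = 0) : β ≤ 1 - 1 / (R * Real.log |γ|) := by
  by_contra hlt
  exact h β γ hγ (not_le.1 hlt) hz

/-- **The output of one run of Kadiri's method** (Mossinghoff–Trudgian 2015, §2), as a predicate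
on its parameters: `T₀` (a height to which the Riemann hypothesis has been verified), `r < R`
(the target and the constant of the region already established) and the value `R₀` produced by
the master inequality (2.2)/(3.1): "We suppose that `ζ(s)` has a zero `ρ₀ = β₀ + iγ₀` with
`γ₀ > 0` which lies just outside an established zero-free region, so that
`1 − 1/(r log γ₀) ≤ β₀ ≤ 1 − 1/(R log γ₀)`. We aim to show that `β₀` in fact satisfies
`β₀ ≤ 1 − 1/(R₀ log γ₀)`." Here only `γ₀ > T₀` is recorded (below `T₀` the strip is empty by the
verification of RH). This file proves only the bookkeeping around this predicate
(`HasOpenClassicalZeroFreeRegion.of_kadiriStripBound`, the iteration, and the reduction of leaf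
(B) of `ExplicitZeroFreeRegion.lean` to it); establishing it for the parameters of
Mossinghoff–Trudgian–Yang §9 is the analytic content of their Theorem 1.3 (Kadiri's explicit
formula and error terms, and the certified numerical iteration), which is NOT in the tree.
[cite: MossinghoffTrudgian2015, §2] [cite: MossinghoffTrudgianYangRNT2024, §9] -/
def KadiriStripBound (T₀ r R R₀ : ℝ) : Prop :=
  ∀ β γ : ℝ, riemannZeta (β + γ * I) = 0 → T₀ < γ → 1 - 1 / (r * Real.log γ) ≤ β →
    β ≤ 1 - 1 / (R * Real.log γ) → β ≤ 1 - 1 / (R₀ * Real.log γ)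

/-- The strip bound is monotone in the output constant (`0 < R₀ ≤ R₀'`) for heights `T₀ ≥ 1`.
[folklore] -/
theorem KadiriStripBound.mono {T₀ r R R₀ R₀' : ℝ} (h : KadiriStripBound T₀ r R R₀) (hT₀ : 1 ≤ T₀)
    (hR₀ : 0 < R₀) (hle : R₀ ≤ R₀') : KadiriStripBound T₀ r R R₀' := by
  intro β γ hz hγ hr hR
  have hlog : 0 < Real.log γ := Real.log_pos (by linarith)
  have h1 : 1 / (R₀' * Real.log γ) ≤ 1 / (R₀ * Real.log γ) :=
    one_div_le_one_div_of_le (by positivity) (by nlinarith)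
  linarith [h β γ hz hγ hr hR]

/-- **One step of the iteration** (Mossinghoff–Trudgian 2015, §2: "one replaces `R` by this `R₀`
… and performs the computation again"; Kadiri 2005, §2.4). If RH is verified up to height `T₀`
with `T₀ ≤ 3 000 175 332 800` (leaf (A), `platt_trudgian_numerical_rh`), the open region with
constant `R` is known, and Kadiri's method has produced the strip bound with output `R₀`
(`r ≤ R₀`, `R₀ ≥ 2.9` so that the region lies right of the critical line), then the open region
with constant `R₀` holds: a zero `β + iγ`, `γ ≥ 2`, either has `γ ≤ T₀` (then `β = 1/2`), or
`β < 1 − 1/(r log γ) ≤ 1 − 1/(R₀ log γ)`, or lies in the strip, where the bound applies; negative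
`γ` by conjugation. [cite: MossinghoffTrudgian2015, §2] [cite: Kadiri2005, §2.4] -/
theorem HasOpenClassicalZeroFreeRegion.of_kadiriStripBound {T₀ r R R₀ : ℝ}
    (hA : platt_trudgian_numerical_rh) (hT₀ : T₀ ≤ 3000175332800)
    (hR : HasOpenClassicalZeroFreeRegion R) (h : KadiriStripBound T₀ r R R₀)
    (hr : 0 < r) (hrR₀ : r ≤ R₀) (hR₀ : 2.9 ≤ R₀) : HasOpenClassicalZeroFreeRegion R₀ := by
  refine forall_abs_of_forall_pos (P := fun σ t ↦ 1 - 1 / (R₀ * Real.log t) < σ) ?_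
  intro σ t ht hσ hzero
  have hlogt : 0 < Real.log t := Real.log_pos (by linarith)
  have htabs : |t| = t := abs_of_nonneg (by linarith)
  rcases le_or_gt t T₀ with hsmall | hlarge
  · -- below `T₀`: the zero is on the critical line, but the region lies to its right
    have hre : (σ + t * I : ℂ).re = 1 / 2 :=
      hA (σ + t * I) hzero (by simp; linarith) (by simp; linarith)
    have hhalf : 1 / 2 < σ :=
      one_half_lt_of_hasClassicalZeroFreeRegion_hyp (t := t) hR₀ (by rwa [htabs])
        (by rw [htabs]; exact hσ.le)
    simp at hre
    linarith
  · rcases lt_or_ge σ (1 - 1 / (r * Real.log t)) with hout | hin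
    · -- left of the strip: already excluded by the target constant `r ≤ R₀`
      have h1 : 1 / (R₀ * Real.log t) ≤ 1 / (r * Real.log t) :=
        one_div_le_one_div_of_le (by positivity) (by nlinarith)
      linarith
    · -- inside the strip: the bound applies
      have hup : σ ≤ 1 - 1 / (R * Real.log t) := by
        have := hR.re_le (β := σ) (γ := t) (by rw [htabs]; exact ht) hzero
        rwa [htabs] at this
      have := h σ t hzero hlarge hin hup
      linarith

/-- **The iteration** (Kadiri 2005, §2.4; Mossinghoff–Trudgian 2015, §§2–3; Mossinghoff–Trudgian–
Yang 2024, §9 and Table 4): from the open region with constant `c 0` and strip bounds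
`c i ↦ c (i+1)` for `i < k` (all with the same `T₀`, `r`), the open region with constant `c k`.
[cite: MossinghoffTrudgian2015, §§2–3] [cite: MossinghoffTrudgianYangRNT2024, §9] -/
theorem HasOpenClassicalZeroFreeRegion.of_kadiriStripBound_chain {T₀ r : ℝ} {c : ℕ → ℝ} {k : ℕ}
    (hA : platt_trudgian_numerical_rh) (hT₀ : T₀ ≤ 3000175332800)
    (h0 : HasOpenClassicalZeroFreeRegion (c 0))
    (hstep : ∀ i < k, KadiriStripBound T₀ r (c i) (c (i + 1)))
    (hr : 0 < r) (hrc : ∀ i ≤ k, r ≤ c i) (hc : ∀ i ≤ k, 2.9 ≤ c i) :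
    HasOpenClassicalZeroFreeRegion (c k) := by
  induction k with
  | zero => exact h0
  | succ k ih =>
    have hk : HasOpenClassicalZeroFreeRegion (c k) :=
      ih (fun i hi ↦ hstep i (Nat.lt_succ_of_lt hi)) (fun i hi ↦ hrc i (Nat.le_succ_of_le hi))
        (fun i hi ↦ hc i (Nat.le_succ_of_le hi))
    exact hk.of_kadiriStripBound hA hT₀ (hstep k (Nat.lt_succ_self k)) hr
      (hrc (k + 1) le_rfl) (hc (k + 1) le_rfl)

/-- **Leaf (B) from the output of the method.** If the open region with some constant `R` is
known (in Mossinghoff–Trudgian–Yang §9: `R = 5.573412`, Theorem 1 of Mossinghoff–Trudgian 2015,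
or the last-but-one iterate) and Kadiri's method with `T₀ = 3·10¹²`, `r = 5` has produced a strip
bound with output constant `R₀ < 5.558691` (MTY: "after seven iterations we compute the value
`R₀ = 5.5586904517`"), then `zero_free_region_mossinghoff_trudgian_yang_large_height` holds: a zero
`β + iγ` with `γ > 3·10¹²`, `β ≥ 1 − 1/(5.558691 log γ)` lies in the strip (`β < 1` by
non-vanishing on `Re s ≥ 1`), so `β ≤ 1 − 1/(R₀ log γ) < 1 − 1/(5.558691 log γ)`.
[cite: MossinghoffTrudgianYangRNT2024, §9 (R₀ = 5.5586904517) and Theorem 1.3] -/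
theorem zero_free_region_mossinghoff_trudgian_yang_large_height_of_kadiriStripBound {R R₀ : ℝ}
    (hR : HasOpenClassicalZeroFreeRegion R) (h : KadiriStripBound (3 * 10 ^ 12) 5 R R₀)
    (hR₀ : 0 < R₀) (hR₀' : R₀ < 5.558691) :
    zero_free_region_mossinghoff_trudgian_yang_large_height := by
  intro σ t ht hσ hzero
  have hlogt : 0 < Real.log t := Real.log_pos (by linarith)
  have htabs : |t| = t := abs_of_nonneg (by linarith)
  have hin : 1 - 1 / (5 * Real.log t) ≤ σ := by
    have h1 : 1 / (5.558691 * Real.log t) ≤ 1 / (5 * Real.log t) :=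
      one_div_le_one_div_of_le (by positivity) (by nlinarith)
    linarith
  have hup : σ ≤ 1 - 1 / (R * Real.log t) := by
    have := hR.re_le (β := σ) (γ := t) (by rw [htabs]; linarith) hzero
    rwa [htabs] at this
  have hout := h σ t hzero ht hin hup
  have hlt : 1 / (5.558691 * Real.log t) < 1 / (R₀ * Real.log t) :=
    one_div_lt_one_div_of_lt (by positivity) (by nlinarith)
  linarith

/-- The specialisation used in Mossinghoff–Trudgian–Yang §9: starting region `R = 5.573412`
(Theorem 1 of Mossinghoff–Trudgian 2015, (B₀), in its open-region spelling
`HasOpenClassicalZeroFreeRegion 5.573412`) and final output `R₀ = 5.5586904517`.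
[cite: MossinghoffTrudgianYangRNT2024, §9] [cite: MossinghoffTrudgian2015, Theorem 1] -/
theorem zero_free_region_mossinghoff_trudgian_yang_large_height_of_mt2015
    (hB₀ : HasOpenClassicalZeroFreeRegion 5.573412)
    (h : KadiriStripBound (3 * 10 ^ 12) 5 5.573412 5.5586904517) :
    zero_free_region_mossinghoff_trudgian_yang_large_height :=
  zero_free_region_mossinghoff_trudgian_yang_large_height_of_kadiriStripBound hB₀ h (by norm_num)
    (by norm_num)

/-- Conversely leaf (B) gives the strip bound with `T₀ = 3·10¹²` and output `5.558691` for any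
`r`, `R` (indeed every zero above `3·10¹²` has `β < 1 − 1/(5.558691 log γ)`), so the predicate is
exactly the currency of the method. [cite: MossinghoffTrudgianYangRNT2024, Theorem 1.3] -/
theorem kadiriStripBound_of_large_height (h : zero_free_region_mossinghoff_trudgian_yang_large_height)
    (r R : ℝ) : KadiriStripBound (3 * 10 ^ 12) r R 5.558691 := by
  intro β γ hz hγ _ _
  by_contra hlt
  exact h β γ hγ (not_le.1 hlt).le hz

/-! ### The empty-strip form (Mossinghoff–Trudgian's reading of the method) -/

/-- **The empty-strip form of the output.** With `η = 1/(r log γ₀)` as in (2.1) of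
Mossinghoff–Trudgian 2015 (the kernel scaled by `η`, a function of the height alone), Kadiri's
fundamental inequality for a zero in the strip reads `r ≤ A g₁(θ)(1 − κ)/(2(K(w, θ) − C(η)))`;
so once `r` exceeds the supremum of the right side over `γ₀ ≥ T₀` (the fixed point of their
inner iteration "reset `r` to the average of its current value and the value of `R₀` just
obtained", e.g. any `r > 5.5586904517` in MTY §9), the strip
`1 − 1/(r log γ₀) ≤ β₀ ≤ 1 − 1/(R log γ₀)`, `γ₀ > T₀`, contains no zero at all. This predicate
records that conclusion; it gives `KadiriStripBound T₀ r R R₀` for every `R₀`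
(`KadiriStripEmpty.stripBound`) and, with leaf (A), the CLOSED region with constant `r`
(`HasClassicalZeroFreeRegion.of_kadiriStripEmpty`). [cite: MossinghoffTrudgian2015, §§2–3]
[cite: MossinghoffTrudgianYangRNT2024, §9 and Table 4] -/
def KadiriStripEmpty (T₀ r R : ℝ) : Prop :=
  ∀ β γ : ℝ, riemannZeta (β + γ * I) = 0 → T₀ < γ → 1 - 1 / (r * Real.log γ) ≤ β →
    ¬ β ≤ 1 - 1 / (R * Real.log γ)

/-- An empty strip bounds vacuously. [folklore] -/
theorem KadiriStripEmpty.stripBound {T₀ r R : ℝ} (h : KadiriStripEmpty T₀ r R) (R₀ : ℝ) :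
    KadiriStripBound T₀ r R R₀ :=
  fun β γ hz hγ hr hR ↦ absurd hR (h β γ hz hγ hr)

/-- Conversely a strip bound with output `R₀ < r` empties the strip (heights `T₀ ≥ 1`,
`0 < R₀`). [folklore] -/
theorem KadiriStripBound.stripEmpty {T₀ r R R₀ : ℝ} (h : KadiriStripBound T₀ r R R₀) (hT₀ : 1 ≤ T₀)
    (hR₀ : 0 < R₀) (hlt : R₀ < r) : KadiriStripEmpty T₀ r R := by
  intro β γ hz hγ hr hR
  have hlog : 0 < Real.log γ := Real.log_pos (by linarith)
  have h1 : 1 / (r * Real.log γ) < 1 / (R₀ * Real.log γ) :=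
    one_div_lt_one_div_of_lt (by positivity) (by nlinarith)
  linarith [h β γ hz hγ hr hR]

/-- **One step, empty-strip form:** leaf (A) (RH to height `T₀ ≤ 3 000 175 332 800`), the open
region with constant `R`, and the empty strip for `(T₀, r, R)` with `r ≥ 2.9` give the CLOSED
classical region with constant `r` (`HasClassicalZeroFreeRegion r`: `ζ ≠ 0` for `|t| ≥ 2`,
`σ ≥ 1 − 1/(r log|t|)`), hence the open one for the next round.
[cite: MossinghoffTrudgian2015, §§2–3] [cite: MossinghoffTrudgianYangRNT2024, §9] -/
theorem HasClassicalZeroFreeRegion.of_kadiriStripEmpty {T₀ r R : ℝ}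
    (hA : platt_trudgian_numerical_rh) (hT₀ : T₀ ≤ 3000175332800)
    (hR : HasOpenClassicalZeroFreeRegion R) (h : KadiriStripEmpty T₀ r R) (hr : 2.9 ≤ r) :
    HasClassicalZeroFreeRegion r := by
  refine forall_abs_of_forall_pos (P := fun σ t ↦ 1 - 1 / (r * Real.log t) ≤ σ) ?_
  intro σ t ht hσ hzero
  have htabs : |t| = t := abs_of_nonneg (by linarith)
  rcases le_or_gt t T₀ with hsmall | hlarge
  · have hre : (σ + t * I : ℂ).re = 1 / 2 :=
      hA (σ + t * I) hzero (by simp; linarith) (by simp; linarith)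
    have hhalf : 1 / 2 < σ :=
      one_half_lt_of_hasClassicalZeroFreeRegion_hyp (t := t) hr (by rwa [htabs]) (by rwa [htabs])
    simp at hre
    linarith
  · have hup : σ ≤ 1 - 1 / (R * Real.log t) := by
      have := hR.re_le (β := σ) (γ := t) (by rw [htabs]; exact ht) hzero
      rwa [htabs] at this
    exact h σ t hzero hlarge hσ hup

/-- **Leaf (B) from an empty strip** (the form in which Mossinghoff–Trudgian–Yang's computation
delivers Theorem 1.3 above `T₀ = 3·10¹²`: with `r = 5.558691 > 5.5586904517` the strip
`1 − 1/(5.558691 log γ₀) ≤ β₀ ≤ 1 − 1/(R log γ₀)`, `γ₀ > 3·10¹²`, is empty, `R` the constant of the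
previous round or `5.573412`): then `zero_free_region_mossinghoff_trudgian_yang_large_height`.
[cite: MossinghoffTrudgianYangRNT2024, §9 and Theorem 1.3] -/
theorem zero_free_region_mossinghoff_trudgian_yang_large_height_of_kadiriStripEmpty {R : ℝ}
    (hR : HasOpenClassicalZeroFreeRegion R) (h : KadiriStripEmpty (3 * 10 ^ 12) 5.558691 R) :
    zero_free_region_mossinghoff_trudgian_yang_large_height := by
  intro σ t ht hσ hzero
  have htabs : |t| = t := abs_of_nonneg (by linarith)
  have hup : σ ≤ 1 - 1 / (R * Real.log t) := by
    have := hR.re_le (β := σ) (γ := t) (by rw [htabs]; linarith) hzero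
    rwa [htabs] at this
  exact h σ t hzero ht hσ hup

/-- And conversely leaf (B) empties that strip (for any `R`), so given the open region with some
constant `R` leaf (B) is EQUIVALENT to the empty strip `(3·10¹², 5.558691, R)`.
[cite: MossinghoffTrudgianYangRNT2024, Theorem 1.3] -/
theorem kadiriStripEmpty_iff_large_height {R : ℝ} (hR : HasOpenClassicalZeroFreeRegion R) :
    KadiriStripEmpty (3 * 10 ^ 12) 5.558691 R ↔
      zero_free_region_mossinghoff_trudgian_yang_large_height :=
  ⟨zero_free_region_mossinghoff_trudgian_yang_large_height_of_kadiriStripEmpty hR,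
    fun h β γ hz hγ hr _ ↦ h β γ hγ hr hz⟩


end Literature.NumberTheory.LFunctions
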